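import Summits.BirchSwinnertonDyer.BirchSwinnertonDyer.Theorems.TwoAdicConverseEulerCharKernelAtTwoPub
import Summits.BirchSwinnertonDyer.BirchSwinnertonDyer.Theorems.ByReductionTypeAtTwoTorsionEulerCharH46
import HarnessLib

set_option linter.dupNamespace false -- `…BirchSwinnertonDyer.BirchSwinnertonDyer…` is the cell's nested layout (D-0017)
set_option autoImplicit false

/-!
# Route `TwoAdicConverse` (rung S3): Greenberg's parity-free Thm. 4.1 `thm41_charValue_rankZero_anyPrime` IS A THEOREM —
# PUB 19167 from {modularity, Kato 17.4@2}; item 19218 from those two printed facts and the crux alone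

Cell `bsd-2adic` (run/shared/lean/pub/bsd-2adic/), seat `bsd-2adic-conv-1` (GEN 37).  THEOREMS ONLY — no definition, no named fact, no
instance, no axiom, no `sorry`; `--supports stmt-BirchSwinnertonDyer-19218`.  HONEST FRAMING: item 19218 stays OPEN (its crux 19556
`OrdLambdaHalfAtTwo` is open); PUB 19167 remains a by-name item; BSD is not proved by any of this.  PARTITION (D-0054): none — RANK axis
(S3); companion formula cell X5@2 good-ord; DISCHARGES one displayed PRINT binder (Greenberg, LNM 1716, Thm. 4.1, parity-free named fact)
on the whole cell; closes none; nothing booked.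

WHAT.  Seat `bsd-2adic-tower-1` GEN 39 (p759195, `TorsionEulerChar.H46.twoAdicEulerCharRankZero`) proved the `p = 2` display
`X5.O1.TwoAdicEulerCharRankZero W 0` for EVERY globally minimal elliptic `W/ℚ` (no (T₁)@2, any rational `2`-torsion: `H46` through the B6
universal-norm schedule), after GEN 35's odd-prime theorem `greenberg_charValue_rankZero_holds` (p744164).  Fed into this seat's
`thm41_charValue_rankZero_anyPrime_of_evenTorsion` (p749123):

* §1 ★ `thm41_charValue_rankZero_anyPrime_holds : Greenberg1999.thm41_charValue_rankZero_anyPrime` — the NAMED FACT «Greenberg 1999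
  Thm. 4.1 over `ℚ`, rank `0`, at EVERY good ordinary prime» is a kernel theorem (axioms trio); the odd fact was tower-1's p744164.
* §2 `ordConversePublishedInputsAtTwo_of_modularity_of_kato (hmod) (h17)` — the ROUTE decl of PUB item 19167 from its first two conjuncts;
  its third conjunct is supplied by §1.  Board sentence: PUB 19167 = PRINT {modularity, Kato 17.4 (1)(2)@2}.
* §3 the S3 per-curve rank-`0` `2`-converse with NO Euler-characteristic hypothesis at all
  (`analyticRank_eq_zero_of_selmerCorank_eq_zero_of_lambdaHalf`: PRINT {modularity, Kato 17.4@2 at `W`} + the leaf `LambdaHalfAtTwo W`), and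
  ★ `goodOrdinaryRankZeroTwoConverse_of_ordLambdaHalfAtTwo (hmod) (h17) (hΛ : OrdLambdaHalfAtTwo) : GoodOrdinaryRankZeroTwoConverse` — ITEM
  19218 (route decl) from PRINT {modularity, Kato 17.4 (1)(2)@2} and the crux 19556 ONLY (neither Greenberg's Thm. 4.1 nor Mazur–Kenku is
  an input; supersedes the (ISO-T₁)/Mazur–Kenku road of p749231 / tower-1 p751673 for the sheet, which stay as the isogeny-class record).

References: [GreenbergLNM1716] Thm. 4.1 (p. 102), §4 Lemmas 4.6–4.7 (pp. 105–108); [Kato2004Asterisque] Thm. 17.4 (1)(2) (p. 273);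
[BCDTJAMS2001] Thm. A; [GreenbergVatsal2000] p. 4 (shape).
-/

noncomputable section

open scoped Classical MatrixGroups ModularForm NumberField

open CongruenceSubgroup WeierstrassCurve NumberField IsDedekindDomain Field
  Literature.NumberTheory.EllipticCurves Literature.NumberTheory.EllipticCurves.ModularForms
  Literature.NumberTheory.EllipticCurves.Rank1Residual Summit.BirchSwinnertonDyer.Rank1Residual.X5.O1

namespace Summit.BirchSwinnertonDyer.BirchSwinnertonDyer.Theorems.TwoAdicEulerCharKernel

/-! ## §1 The named fact is a theorem -/

/-- **Greenberg, LNM 1716 (1999), Theorem 4.1 over `ℚ`, rank `0`, at EVERY good ordinary prime — the named fact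
`Greenberg1999.thm41_charValue_rankZero_anyPrime` DISCHARGED**: `f_E(0)·#E(ℚ)(p)² = u·p^{ord_p ∏ c_ℓ}·#Ẽ(𝔽_p)(p)²·#Sel_{p^∞}(E/ℚ)`,
`u ∈ ℤ_pˣ`, for `W` globally minimal, `p` good ordinary, `Sel` finite.  Odd `p`: tower-1's `greenberg_charValue_rankZero_holds` (inside
`thm41_charValue_rankZero_anyPrime_of_evenTorsion`); `p = 2`: tower-1's `TorsionEulerChar.H46.twoAdicEulerCharRankZero` for every curve.
[cite: GreenbergLNM1716, Thm. 4.1 (p. 102), §4 Lemmas 4.6–4.7 (pp. 105–108)] -/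
theorem thm41_charValue_rankZero_anyPrime_holds : Greenberg1999.thm41_charValue_rankZero_anyPrime :=
  thm41_charValue_rankZero_anyPrime_of_evenTorsion fun W _ _ _ => TorsionEulerChar.H46.twoAdicEulerCharRankZero W

/-! ## §2 PUB 19167 from its first two conjuncts -/

/-- **The route decl `OrdConversePublishedInputsAtTwo` (PUB item 19167, by name) from modularity and Kato 17.4 (1)(2)@2 alone** — the
third conjunct (Greenberg's Thm. 4.1, parity-free) is the theorem of §1.  Board sentence: PUB 19167 = PRINT {modularity, Kato 17.4@2}.
[cite: BCDTJAMS2001, Thm. A] [cite: Kato2004Asterisque, Thm. 17.4 (1)(2) (p. 273)] [cite: GreenbergLNM1716, Thm. 4.1 (p. 102)] -/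
theorem ordConversePublishedInputsAtTwo_of_modularity_of_kato
    (hmod : nonempty_modularParametrizationData)
    (h17 : ∀ (W : WeierstrassCurve ℚ) [W.IsElliptic] [W.IsGloballyMinimal]
      [NeZero (W.conductorNorm ℤ)] (f : CuspForm (Gamma0 (W.conductorNorm ℤ)) 2),
      kato_divisibility_allPrimes W 2 (f := f)) :
    Summit.BirchSwinnertonDyer.BirchSwinnertonDyer.Theses.TwoAdicConverse.OrdConversePublishedInputsAtTwo :=
  ⟨hmod, fun W _ _ _ f => h17 W f, thm41_charValue_rankZero_anyPrime_holds⟩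

/-! ## §3 The S3 converse with no Euler-characteristic hypothesis -/

section Curve

variable (W : WeierstrassCurve ℚ) [W.IsElliptic] [W.IsGloballyMinimal]

/-- **THE CONVERSE AT `W` FROM THE LEAF, NO EULER-CHARACTERISTIC HYPOTHESIS.**  `W` globally minimal, good ordinary at `2`; PRINT at `W`:
modularity, Kato 17.4 (1)(2)@2; OPEN: the leaf `LambdaHalfAtTwo W`.  Then `corank_{ℤ₂} Sel_{2^∞}(W/ℚ) = 0 ⇒ r_an(W) = 0` — Greenberg's
Thm. 4.1 at `2` enters as tower-1's kernel theorem `TorsionEulerChar.H46.twoAdicEulerCharRankZero`. [cite: GreenbergLNM1716, Thm. 4.1 (p. 102)]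
[cite: Kato2004Asterisque, Thm. 17.4 (1)(2) (p. 273)] [cite: GreenbergVatsal2000, p. 4 (after Thm. (1.2)) (shape; p odd)] -/
theorem analyticRank_eq_zero_of_selmerCorank_eq_zero_of_lambdaHalf
    (hmod : nonempty_modularParametrizationData)
    (h17 : ∀ [NeZero (W.conductorNorm ℤ)] (f : CuspForm (Gamma0 (W.conductorNorm ℤ)) 2),
      kato_divisibility_allPrimes W 2 (f := f))
    (hgo : GoodOrd W 2) (hΛ : TwoAdicTwistConverse.LambdaHalfAtTwo W)
    (hsel : W.selmerCorank 2 = 0) : W.analyticRank = 0 :=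
  analyticRank_eq_zero_of_selmerCorank_eq_zero_of_lambdaHalf_of_eulerChar W hmod h17 (TorsionEulerChar.H46.twoAdicEulerCharRankZero W) hgo hΛ hsel

/-- **THE CONVERSE AT `W` FROM A `λ`-DATUM, NO EULER-CHARACTERISTIC HYPOTHESIS** (the `hΛ` binder shape of p424885's
`analyticRank_eq_zero_of_selmerCorank_eq_zero_of_lam_le`, `hGr` GONE). [cite: GreenbergLNM1716, Thm. 4.1 (p. 102)]
[cite: Kato2004Asterisque, Thm. 17.4 (1)(2) (p. 273)] -/
theorem analyticRank_eq_zero_of_selmerCorank_eq_zero_of_lam_le'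
    (hmod : nonempty_modularParametrizationData)
    (h17 : ∀ [NeZero (W.conductorNorm ℤ)] (f : CuspForm (Gamma0 (W.conductorNorm ℤ)) 2),
      kato_divisibility_allPrimes W 2 (f := f))
    (hgo : GoodOrd W 2)
    (hΛ : ∀ (κ : ZpExtension ℚ 2) (γ : Field.absoluteGaloisGroup ℚ),
      κ.IsCyclotomic → κ.IsTopGenerator γ → IsCyclotomicVariable 2 γ →
      ∀ [NeZero (W.conductorNorm ℤ)] (f : CuspForm (Gamma0 (W.conductorNorm ℤ)) 2), IsNewformOf W f →
      ∀ (D : W.SelmerDualData κ γ), ∃ (c : ℚ) (L₀ : IwasawaAlgebra 2), L₀ ≠ 0 ∧ iwasawaToPowerSeries 2 L₀ =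
          PowerSeries.C (c : ℚ_[2]) * padicLFunction f (unitRoot W 2 : ℚ_[2]) ∧
          Summit.BirchSwinnertonDyer.Rank1Residual.X1.MuLambda.lam L₀ ≤ D.lambda)
    (hsel : W.selmerCorank 2 = 0) : W.analyticRank = 0 :=
  analyticRank_eq_zero_of_selmerCorank_eq_zero_of_lam_le_of_eulerChar W hmod h17 (TorsionEulerChar.H46.twoAdicEulerCharRankZero W) hgo hΛ hsel

end Curve

section Route

open Summit.BirchSwinnertonDyer.BirchSwinnertonDyer.Theses.TwoAdicConverse (OrdLambdaHalfAtTwo GoodOrdinaryRankZeroTwoConverse)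

/-- **ITEM 19218 FROM TWO PRINTED FACTS AND THE CRUX.**  `GoodOrdinaryRankZeroTwoConverse` (route decl, by name) from modularity
(`hmod`), Kato 17.4 (1)(2)@2 class-wide (`h17`) and the route crux `OrdLambdaHalfAtTwo` (item 19556, by name) — nothing else: Greenberg's
Thm. 4.1 at `2` is tower-1's kernel theorem `TorsionEulerChar.H46.twoAdicEulerCharRankZero`, and no isogeny-class hypothesis is needed.  A REDUCTION; the crux is
open. [cite: GreenbergLNM1716, Thm. 4.1 (p. 102)] [cite: Kato2004Asterisque, Thm. 17.4 (1)(2) (p. 273)]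
[cite: GreenbergVatsal2000, p. 4 (after Thm. (1.2)) (shape; p odd)] -/
theorem goodOrdinaryRankZeroTwoConverse_of_ordLambdaHalfAtTwo
    (hmod : nonempty_modularParametrizationData)
    (h17 : ∀ (W : WeierstrassCurve ℚ) [W.IsElliptic] [W.IsGloballyMinimal]
      [NeZero (W.conductorNorm ℤ)] (f : CuspForm (Gamma0 (W.conductorNorm ℤ)) 2),
      kato_divisibility_allPrimes W 2 (f := f))
    (hΛ : OrdLambdaHalfAtTwo) : GoodOrdinaryRankZeroTwoConverse := by
  intro W _ _ hcm hgo hsel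
  exact analyticRank_eq_zero_of_selmerCorank_eq_zero_of_lam_le_of_eulerChar W hmod (fun f => h17 W f)
    (TorsionEulerChar.H46.twoAdicEulerCharRankZero W) hgo (fun κ γ hκ hγ hγ' _ f hf D => hΛ W hcm hgo κ γ hκ hγ hγ' hgo f hf D) hsel

/-- **The same through PUB 19167's route decl** — `OrdConversePublishedInputsAtTwo → OrdLambdaHalfAtTwo → GoodOrdinaryRankZeroTwoConverse`
(the CLOSED glue 19557's shape), now with PUB itself obtainable from {modularity, Kato 17.4@2} (§2). [cite: GreenbergLNM1716, Thm. 4.1 (p. 102)] -/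
theorem goodOrdinaryRankZeroTwoConverse_of_modularity_of_kato_of_ordLambdaHalfAtTwo
    (hmod : nonempty_modularParametrizationData)
    (h17 : ∀ (W : WeierstrassCurve ℚ) [W.IsElliptic] [W.IsGloballyMinimal]
      [NeZero (W.conductorNorm ℤ)] (f : CuspForm (Gamma0 (W.conductorNorm ℤ)) 2),
      kato_divisibility_allPrimes W 2 (f := f))
    (hΛ : OrdLambdaHalfAtTwo) :
    Summit.BirchSwinnertonDyer.BirchSwinnertonDyer.Theses.TwoAdicConverse.OrdConversePublishedInputsAtTwo ∧ GoodOrdinaryRankZeroTwoConverse :=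
  ⟨ordConversePublishedInputsAtTwo_of_modularity_of_kato hmod h17, goodOrdinaryRankZeroTwoConverse_of_ordLambdaHalfAtTwo hmod h17 hΛ⟩

end Route

end Summit.BirchSwinnertonDyer.BirchSwinnertonDyer.Theorems.TwoAdicEulerCharKernel

end
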